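import Literature.MathematicalPhysics.QuantumLattice.HubbardBootstrapCertificate
import Literature.MathematicalPhysics.QuantumLattice.HubbardNNNHoppingRectSymmetries
import HarnessLib

/-!
# Bootstrap / SOS dual certificates and Anderson cluster bounds for number-conserving lattice
# fermion Hamiltonians, and for the `t–t'` Hubbard model on tori

Family `hubbard` (topic `MathematicalPhysics/QuantumLattice`); companion of
`HubbardBootstrapCertificate.lean`, which states the weak-duality glue for the pure Hubbard
Hamiltonian `hamiltonian G t U` only. Here the same five-line glue is stated for an ARBITRARY
Hermitian, sector-preserving operator `H` on the fermionic Fock space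
`Matrix (Finset (Orb Λ)) (Finset (Orb Λ)) ℂ` — an operator identity

`H − c·1 = Σᵢⱼ Λᵢⱼ Oᵢᴴ Oⱼ + Σₖ (H Xₖ − Xₖ H) + Σₗ (Yₗ (N̂ − N) + (N̂ − N) Y'ₗ)`, `Λ ⪰ 0`,

certifies `c ≤ groundEnergy H N` for every `N ≤ 2|Λ|` (`groundEnergy_ge_of_certificate_of_preservesSectors`; Han's
bootstrap constraints `⟨[H,O]⟩ = 0` in an energy eigenstate and the particle-number ideal of
Rubin–Low–DePrince §III.A) — and it is then specialised to the two-graph Hamiltonians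
`hamiltonian G t U + hamiltonian G' t' U'` and to the published `t–t'` Hubbard Hamiltonians
`hubbardRectTorusTT' a b t t' U`, `hubbardTorusTT' L t t' U` (LeBlanc et al. 2015 eq. (1); Xu et al.
2024 eq. (1)), which are the statement shapes in which finite-torus SDP certificates at `t' ≠ 0`
enter the tree. The purely static case (no commutator, no ideal term: `H − c·1` a Gram form) is
**Anderson's cluster lower bound** in certificate form (`groundEnergy_ge_of_gramForm`), and the
superadditivity of the sector ground energy over sums of sector-preserving Hermitian operators
(`groundEnergy_add_ge`, `sum_groundEnergy_le`) is the form in which cluster decompositions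
`H = Σ_p H_p` give `Σ_p E₀(H_p) ≤ E₀(H)` (Anderson 1951; for the two-dimensional Hubbard model:
Valentí–Stolze–Hirschfeld 1991). Everything is PROVED; no definition and no named fact is introduced.

## References
* X. Han, *Quantum many-body bootstrap*, arXiv:2006.06002 (2020), §2–3. [cite: Han2020Bootstrap, §2]
* N. C. Rubin, G. H. Low, A. E. DePrince III, arXiv:2602.05069 (2026), §III.A. [cite: RubinLowDePrince2026, §III.A]
* P. W. Anderson, Phys. Rev. 83 (1951) 1260 (cluster lower bounds). [cite: Anderson1951]
* R. Valentí, J. Stolze, P. J. Hirschfeld, Phys. Rev. B 43 (1991) 13743 (cluster lower bounds for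
  the ground-state energy of the two-dimensional Hubbard model). [cite: ValentiStolzeHirschfeld1991]
* J. P. F. LeBlanc et al., Phys. Rev. X 5 (2015) 041041, eq. (1). [cite: LeBlancEtAl2015, eq. (1)]
-/

noncomputable section

namespace Literature.MathematicalPhysics.QuantumLattice

open Matrix Finset HubbardWave0 Literature.MathematicalPhysics.QuantumManyBody.StateRelaxation
open scoped ComplexOrder BigOperators

section Generic

variable {Λ : Type*} [LinearOrder Λ] [Fintype Λ]

namespace ThermodynamicLimit

/-- **A normalised ground state exists in every sector `N ≤ 2|Λ|`** of a Hermitian operator that is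
block diagonal in the spin sectors (`PreservesSectors`): `sector_groundState` on the coordinate
subspace `nParticleSubmodule N`. Tasaki (2020) §2.2 (ground states within a sector of a conserved
quantity), §9.2 (particle numbers of the Hubbard model). [cite: Tasaki2020, §2.2] -/
theorem exists_unit_groundState_of_preservesSectors (H : Matrix (Finset (Orb Λ)) (Finset (Orb Λ)) ℂ)
    (hHerm : H.IsHermitian) (hpres : PreservesSectors H) {N : ℕ} (hN : N ≤ 2 * Fintype.card Λ) :
    ∃ ψ : Fock (Orb Λ), IsNParticle N ψ ∧ star ψ ⬝ᵥ ψ = 1 ∧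
      H *ᵥ ψ = ((groundEnergy H N : ℝ) : ℂ) • ψ := by
  classical
  have hc : N ≤ (Finset.univ : Finset (Orb Λ)).card := by rwa [Finset.card_univ, card_orb]
  obtain ⟨s₀, -, hs₀⟩ := Finset.exists_subset_card_eq hc
  have hp : ∃ s : Finset (Orb Λ), s.card = N := ⟨s₀, hs₀⟩
  have hinv : ∀ s s' : Finset (Orb Λ), ¬(s.card = N) → s'.card = N → H s s' = 0 := by
    intro s s' hs hs'
    by_contra h
    have := hpres s s' h
    apply hs
    rw [card_eq_upPart_add_downPart, this.1, this.2, ← card_eq_upPart_add_downPart, hs']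
  obtain ⟨⟨v, hv, hv0, hHv⟩, -⟩ := sector_groundState H hHerm
    (fun s : Finset (Orb Λ) => s.card = N) hp hinv (nParticleSubmodule N) (fun v => Iff.rfl)
  obtain ⟨c, -, hc1⟩ := exists_smul_unit hv0
  refine ⟨c • v, Submodule.smul_mem _ c hv, hc1, ?_⟩
  rw [mulVec_smul, hHv, smul_comm,
    groundEnergy_eq_minEnergyOn H N (nParticleSubmodule N) fun ψ => Iff.rfl]

end ThermodynamicLimit

/-- **Weak duality for a sector-preserving Hermitian operator.** If
`H − c·1 = Σᵢⱼ Λᵢⱼ Oᵢᴴ Oⱼ + Σₖ [H, Xₖ] + Σₗ (Yₗ (N̂ − N) + (N̂ − N) Y'ₗ)` with `Λ ⪰ 0`, then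
`c ≤ E₀(H, N)` for every `N ≤ 2|Λ|`: evaluate in a normalised sector ground state, which kills the
commutators (energy eigenstate) and the particle-number ideal. Han (2020) §2–3; Rubin–Low–DePrince
(2026) §III.A. [cite: Han2020Bootstrap, §2] -/
theorem groundEnergy_ge_of_certificate_of_preservesSectors (H : Matrix (Finset (Orb Λ)) (Finset (Orb Λ)) ℂ)
    (hHerm : H.IsHermitian) (hpres : PreservesSectors H) {N : ℕ} (hN : N ≤ 2 * Fintype.card Λ)
    {m : Type*} [Fintype m] [DecidableEq m] {Λm : Matrix m m ℂ} (hΛ : Λm.PosSemidef)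
    (O : m → Matrix (Finset (Orb Λ)) (Finset (Orb Λ)) ℂ)
    {κ : Type*} (s : Finset κ) (X : κ → Matrix (Finset (Orb Λ)) (Finset (Orb Λ)) ℂ)
    {κ' : Type*} (s' : Finset κ') (Y Y' : κ' → Matrix (Finset (Orb Λ)) (Finset (Orb Λ)) ℂ)
    {c : ℝ}
    (hcert : H - (c : ℂ) • (1 : Matrix (Finset (Orb Λ)) (Finset (Orb Λ)) ℂ) =
      gramForm Λm O + (∑ k ∈ s, (H * X k - X k * H) +
        ∑ l ∈ s', (Y l * (totalNumberOp - (N : ℂ) • 1) + (totalNumberOp - (N : ℂ) • 1) * Y' l))) :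
    c ≤ groundEnergy H N := by
  obtain ⟨ψ, hψN, hψ1, hHψ⟩ :=
    ThermodynamicLimit.exists_unit_groundState_of_preservesSectors H hHerm hpres hN
  exact eigenvalue_ge_of_certificate hHerm hψ1 hHψ hΛ O s X s'
    Y (fun _ => totalNumberOp - (N : ℂ) • 1) (fun _ => totalNumberOp - (N : ℂ) • 1) Y'
    (fun _ _ => totalNumberOp_sub_mulVec_of_isNParticle N hψN)
    (fun _ _ => by
      rw [conjTranspose_totalNumberOp_sub]; exact totalNumberOp_sub_mulVec_of_isNParticle N hψN)
    hcert

/-- **Static (sum-of-squares) certificates**: if `H − c·1 = Σᵢⱼ Λᵢⱼ Oᵢᴴ Oⱼ` with `Λ ⪰ 0` — an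
operator inequality `H ≥ c` witnessed inside the algebra, e.g. cluster by cluster — then
`c ≤ E₀(H, N)` in every sector. This is the certificate form of Anderson's cluster lower bound.
Anderson (1951); Valentí–Stolze–Hirschfeld (1991) §II. [cite: Anderson1951] -/
theorem groundEnergy_ge_of_gramForm (H : Matrix (Finset (Orb Λ)) (Finset (Orb Λ)) ℂ)
    (hHerm : H.IsHermitian) (hpres : PreservesSectors H) {N : ℕ} (hN : N ≤ 2 * Fintype.card Λ)
    {m : Type*} [Fintype m] [DecidableEq m] {Λm : Matrix m m ℂ} (hΛ : Λm.PosSemidef)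
    (O : m → Matrix (Finset (Orb Λ)) (Finset (Orb Λ)) ℂ) {c : ℝ}
    (hcert : H - (c : ℂ) • (1 : Matrix (Finset (Orb Λ)) (Finset (Orb Λ)) ℂ) = gramForm Λm O) :
    c ≤ groundEnergy H N :=
  groundEnergy_ge_of_certificate_of_preservesSectors H hHerm hpres hN hΛ O (∅ : Finset Unit) (fun _ => 0)
    (∅ : Finset Unit) (fun _ => 0) (fun _ => 0) (by simpa using hcert)

/-- **Superadditivity of the sector ground energy** (Anderson's argument): for Hermitian,
sector-preserving `A`, `B`, `E₀(A, N) + E₀(B, N) ≤ E₀(A + B, N)` for `N ≤ 2|Λ|` — evaluate both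
variational bounds in a ground state of `A + B`. Anderson (1951), eq. (2). [cite: Anderson1951, eq. (2)] -/
theorem groundEnergy_add_ge (A B : Matrix (Finset (Orb Λ)) (Finset (Orb Λ)) ℂ)
    (hA : A.IsHermitian) (hB : B.IsHermitian) (hpA : PreservesSectors A) (hpB : PreservesSectors B)
    {N : ℕ} (hN : N ≤ 2 * Fintype.card Λ) :
    groundEnergy A N + groundEnergy B N ≤ groundEnergy (A + B) N := by
  obtain ⟨ψ, hψN, hψ1, hHψ⟩ :=
    ThermodynamicLimit.exists_unit_groundState_of_preservesSectors (A + B) (hA.add hB)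
      (hpA.add hpB) hN
  have hA' := LiebThm1.groundEnergy_le_re_expect A hψN hψ1
  have hB' := LiebThm1.groundEnergy_le_re_expect B hψN hψ1
  have hsum : expect (A + B) ψ = expect A ψ + expect B ψ := by
    unfold expect; rw [add_mulVec, dotProduct_add]
  have hval : expect (A + B) ψ = ((groundEnergy (A + B) N : ℝ) : ℂ) := by
    unfold expect; rw [hHψ, dotProduct_smul, hψ1, smul_eq_mul, mul_one]
  have hre : (expect A ψ).re + (expect B ψ).re = groundEnergy (A + B) N := by
    rw [← Complex.add_re, ← hsum, hval, Complex.ofReal_re]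
  linarith

omit [LinearOrder Λ] [Fintype Λ] in
/-- A finite sum of Hermitian matrices is Hermitian. [folklore] -/
private theorem isHermitian_sum {P : Type*} (S : Finset P)
    (Hf : P → Matrix (Finset (Orb Λ)) (Finset (Orb Λ)) ℂ) (h : ∀ p ∈ S, (Hf p).IsHermitian) :
    (∑ p ∈ S, Hf p).IsHermitian := by
  classical
  induction S using Finset.induction_on with
  | empty => rw [Finset.sum_empty]; exact Matrix.isHermitian_zero
  | @insert p S hp ih =>
    rw [Finset.sum_insert hp]
    exact (h p (Finset.mem_insert_self p S)).add (ih fun q hq => h q (Finset.mem_insert_of_mem hq))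

/-- **Anderson's cluster bound, finite-sum form**: for a nonempty finite family of Hermitian,
sector-preserving operators, `Σ_p E₀(H_p, N) ≤ E₀(Σ_p H_p, N)` (`N ≤ 2|Λ|`). With `H_p` the
sub-Hamiltonians of a bond partition into clusters this is the cluster lower bound for the
ground-state energy. Anderson (1951) eq. (2); Valentí–Stolze–Hirschfeld (1991) §II.
[cite: ValentiStolzeHirschfeld1991, §II] -/
theorem sum_groundEnergy_le {P : Type*} (S : Finset P)
    (Hf : P → Matrix (Finset (Orb Λ)) (Finset (Orb Λ)) ℂ) (hHerm : ∀ p ∈ S, (Hf p).IsHermitian)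
    (hpres : ∀ p ∈ S, PreservesSectors (Hf p)) {N : ℕ} (hN : N ≤ 2 * Fintype.card Λ)
    (hS : S.Nonempty) :
    ∑ p ∈ S, groundEnergy (Hf p) N ≤ groundEnergy (∑ p ∈ S, Hf p) N := by
  classical
  induction S using Finset.induction_on with
  | empty => exact absurd hS Finset.not_nonempty_empty
  | @insert p S hp ih =>
    rw [Finset.sum_insert hp, Finset.sum_insert hp]
    rcases S.eq_empty_or_nonempty with hSe | hSne
    · subst hSe; simp
    · have h1 := ih (fun q hq => hHerm q (Finset.mem_insert_of_mem hq))
        (fun q hq => hpres q (Finset.mem_insert_of_mem hq)) hSne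
      have h2 := groundEnergy_add_ge (Hf p) (∑ q ∈ S, Hf q)
        (hHerm p (Finset.mem_insert_self p S))
        (isHermitian_sum S Hf fun q hq => hHerm q (Finset.mem_insert_of_mem hq))
        (hpres p (Finset.mem_insert_self p S))
        (PreservesSectors.sum fun q hq => hpres q (Finset.mem_insert_of_mem hq)) hN
      linarith

end Generic

section TwoGraph

variable {Λ : Type*} [LinearOrder Λ] [Fintype Λ] (G G' : SimpleGraph Λ) [DecidableRel G.Adj]
  [DecidableRel G'.Adj]

/-- The certificate glue for a **two-graph Hamiltonian** `H = H_G(t,U) + H_{G'}(t',U')` (two bond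
sets with their own hopping amplitudes and on-site couplings; `t–t'` models are `U' = 0`).
Han (2020) §3; LeBlanc et al. (2015) eq. (1). [cite: Han2020Bootstrap, §3] -/
theorem groundEnergy_twoGraph_ge_of_certificate (t U t' U' : ℝ) {N : ℕ}
    (hN : N ≤ 2 * Fintype.card Λ)
    {m : Type*} [Fintype m] [DecidableEq m] {Λm : Matrix m m ℂ} (hΛ : Λm.PosSemidef)
    (O : m → Matrix (Finset (Orb Λ)) (Finset (Orb Λ)) ℂ)
    {κ : Type*} (s : Finset κ) (X : κ → Matrix (Finset (Orb Λ)) (Finset (Orb Λ)) ℂ)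
    {κ' : Type*} (s' : Finset κ') (Y Y' : κ' → Matrix (Finset (Orb Λ)) (Finset (Orb Λ)) ℂ)
    {c : ℝ}
    (hcert : (hamiltonian G t U + hamiltonian G' t' U') -
        (c : ℂ) • (1 : Matrix (Finset (Orb Λ)) (Finset (Orb Λ)) ℂ) =
      gramForm Λm O + (∑ k ∈ s, ((hamiltonian G t U + hamiltonian G' t' U') * X k -
          X k * (hamiltonian G t U + hamiltonian G' t' U')) +
        ∑ l ∈ s', (Y l * (totalNumberOp - (N : ℂ) • 1) + (totalNumberOp - (N : ℂ) • 1) * Y' l))) :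
    c ≤ groundEnergy (hamiltonian G t U + hamiltonian G' t' U') N :=
  groundEnergy_ge_of_certificate_of_preservesSectors _
    ((LiebThm1.hamiltonian_isHermitian G t U).add (LiebThm1.hamiltonian_isHermitian G' t' U'))
    ((LiebThm1.preservesSectors_hamiltonian G t U).add
      (LiebThm1.preservesSectors_hamiltonian G' t' U'))
    hN hΛ O s X s' Y Y' hcert

end TwoGraph

section Rect

open Literature.Probability.LatticeModels

/-- The rectangular `t–t'` Hamiltonian conserves `N↑` and `N↓`. LeBlanc et al. (2015) eq. (1);
Lieb (1989) Remark (2)(i). [cite: LeBlancEtAl2015, eq. (1)] -/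
theorem preservesSectors_hubbardRectTorusTT' (a b : ℕ) (t t' U : ℝ) :
    PreservesSectors (hubbardRectTorusTT' a b t t' U) := by
  unfold hubbardRectTorusTT'
  exact (LiebThm1.preservesSectors_hamiltonian _ t U).add (LiebThm1.preservesSectors_hamiltonian _ t' 0)

/-- **Finite-torus SDP / SOS certificates for the `t–t'` Hubbard model** on `ℤ/aℤ × ℤ/bℤ`: an
operator identity `H − c·1 = Σ Λᵢⱼ Oᵢᴴ Oⱼ + Σ [H, Xₖ] + Σ (Yₗ (N̂ − N) + (N̂ − N) Y'ₗ)`, `Λ ⪰ 0`,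
for `H = hubbardRectTorusTT' a b t t' U` certifies `c ≤ E₀(H, N)` (`N ≤ 2ab`). This is the
statement shape of a certified LOWER endpoint at `t' ≠ 0`. Han (2020) §3; LeBlanc et al. (2015)
eq. (1). [cite: Han2020Bootstrap, §3] -/
theorem groundEnergy_hubbardRectTorusTT'_ge_of_certificate (a b : ℕ) (t t' U : ℝ) {N : ℕ}
    (hN : N ≤ 2 * (a * b))
    {m : Type*} [Fintype m] [DecidableEq m] {Λm : Matrix m m ℂ} (hΛ : Λm.PosSemidef)
    (O : m → Matrix (Finset (Orb (Fin a ×ₗ Fin b))) (Finset (Orb (Fin a ×ₗ Fin b))) ℂ)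
    {κ : Type*} (s : Finset κ)
    (X : κ → Matrix (Finset (Orb (Fin a ×ₗ Fin b))) (Finset (Orb (Fin a ×ₗ Fin b))) ℂ)
    {κ' : Type*} (s' : Finset κ')
    (Y Y' : κ' → Matrix (Finset (Orb (Fin a ×ₗ Fin b))) (Finset (Orb (Fin a ×ₗ Fin b))) ℂ)
    {c : ℝ}
    (hcert : hubbardRectTorusTT' a b t t' U -
        (c : ℂ) • (1 : Matrix (Finset (Orb (Fin a ×ₗ Fin b))) (Finset (Orb (Fin a ×ₗ Fin b))) ℂ) =
      gramForm Λm O + (∑ k ∈ s, (hubbardRectTorusTT' a b t t' U * X k -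
          X k * hubbardRectTorusTT' a b t t' U) +
        ∑ l ∈ s', (Y l * (totalNumberOp - (N : ℂ) • 1) + (totalNumberOp - (N : ℂ) • 1) * Y' l))) :
    c ≤ groundEnergy (hubbardRectTorusTT' a b t t' U) N :=
  groundEnergy_ge_of_certificate_of_preservesSectors (hubbardRectTorusTT' a b t t' U) (hubbardRectTorusTT'_isHermitian a b t t' U)
    (preservesSectors_hubbardRectTorusTT' a b t t' U) (by rw [card_rectSites]; exact hN)
    hΛ O s X s' Y Y' hcert

/-- **Anderson cluster lower bound for the rectangular `t–t'` torus, certificate form**: if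
`hubbardRectTorusTT' a b t t' U = Σ_{p ∈ S} H_p` with every `H_p` Hermitian and sector-preserving
(e.g. the sub-Hamiltonian of a cluster of a bond partition, with the on-site terms split among the
clusters containing the site) and `σ_p ≤ E₀(H_p, N)` for each `p`, then `Σ_p σ_p ≤ E₀(H, N)`.
Valentí–Stolze–Hirschfeld (1991) §II (square-lattice Hubbard clusters); Anderson (1951).
[cite: ValentiStolzeHirschfeld1991, §II] -/
theorem groundEnergy_hubbardRectTorusTT'_ge_sum_of_clusters (a b : ℕ) (t t' U : ℝ) {N : ℕ}
    (hN : N ≤ 2 * (a * b)) {P : Type*} (S : Finset P) (hS : S.Nonempty)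
    (Hf : P → Matrix (Finset (Orb (Fin a ×ₗ Fin b))) (Finset (Orb (Fin a ×ₗ Fin b))) ℂ)
    (hHerm : ∀ p ∈ S, (Hf p).IsHermitian) (hpres : ∀ p ∈ S, PreservesSectors (Hf p))
    (hsum : hubbardRectTorusTT' a b t t' U = ∑ p ∈ S, Hf p) (σ : P → ℝ)
    (hσ : ∀ p ∈ S, σ p ≤ groundEnergy (Hf p) N) :
    ∑ p ∈ S, σ p ≤ groundEnergy (hubbardRectTorusTT' a b t t' U) N := by
  have hN' : N ≤ 2 * Fintype.card (Fin a ×ₗ Fin b) := by rw [card_rectSites]; exact hN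
  calc ∑ p ∈ S, σ p ≤ ∑ p ∈ S, groundEnergy (Hf p) N := Finset.sum_le_sum hσ
    _ ≤ groundEnergy (∑ p ∈ S, Hf p) N := sum_groundEnergy_le S Hf hHerm hpres hN' hS
    _ = groundEnergy (hubbardRectTorusTT' a b t t' U) N := by rw [hsum]

end Rect

section Square

open Literature.Probability.LatticeModels

variable (L : ℕ)

/-- **Square tori through the rectangular presentation.** A certificate for
`hubbardRectTorusTT' L L t t' U` bounds the sector ground energy of the square `t–t'` torus
`hubbardTorusTT' L t t' U` (`Fin 2 → ZMod L` presentation) as well, the two presentations having the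
same sector energies (`groundEnergy_hubbardTorusTT'_eq_rect`). Certificates at `t' ≠ 0` are
therefore STATED in the rectangular presentation only. Han (2020) §3; Xu et al. (2024) eq. (1).
[cite: Han2020Bootstrap, §3] -/
theorem groundEnergy_hubbardTorusTT'_ge_of_rect_certificate (t t' U : ℝ) {N : ℕ}
    (hN : N ≤ 2 * (L * L))
    {m : Type*} [Fintype m] [DecidableEq m] {Λm : Matrix m m ℂ} (hΛ : Λm.PosSemidef)
    (O : m → Matrix (Finset (Orb (Fin L ×ₗ Fin L))) (Finset (Orb (Fin L ×ₗ Fin L))) ℂ)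
    {κ : Type*} (s : Finset κ)
    (X : κ → Matrix (Finset (Orb (Fin L ×ₗ Fin L))) (Finset (Orb (Fin L ×ₗ Fin L))) ℂ)
    {κ' : Type*} (s' : Finset κ')
    (Y Y' : κ' → Matrix (Finset (Orb (Fin L ×ₗ Fin L))) (Finset (Orb (Fin L ×ₗ Fin L))) ℂ)
    {c : ℝ}
    (hcert : hubbardRectTorusTT' L L t t' U -
        (c : ℂ) • (1 : Matrix (Finset (Orb (Fin L ×ₗ Fin L))) (Finset (Orb (Fin L ×ₗ Fin L))) ℂ) =
      gramForm Λm O + (∑ k ∈ s, (hubbardRectTorusTT' L L t t' U * X k -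
          X k * hubbardRectTorusTT' L L t t' U) +
        ∑ l ∈ s', (Y l * (totalNumberOp - (N : ℂ) • 1) + (totalNumberOp - (N : ℂ) • 1) * Y' l))) :
    c ≤ groundEnergy (hubbardTorusTT' L t t' U) N := by
  rw [groundEnergy_hubbardTorusTT'_eq_rect]
  exact groundEnergy_hubbardRectTorusTT'_ge_of_certificate L L t t' U hN hΛ O s X s' Y Y' hcert

end Square

end Literature.MathematicalPhysics.QuantumLattice
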